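import Summits.BirchSwinnertonDyer.BirchSwinnertonDyer.Theorems.PublishedInputsGreenbergShaTwoFiniteAnyTorsion
import Summits.BirchSwinnertonDyer.BirchSwinnertonDyer.Theorems.ThetaPartnerAtTwoSignedControlAtTwoShaTwoVanishingHolds
import HarnessLib

set_option linter.dupNamespace false -- `…BirchSwinnertonDyer.BirchSwinnertonDyer…` is the cell's nested layout (D-0017)
set_option autoImplicit false

/-!
# `Ш²(K, E[p^∞]) = 0`, DIV «`(γ − 1)·H¹(K_∞, E[p^∞]) = H¹(K_∞, E[p^∞])`» and «no nonzero finite `Λ`-submodule in the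
# dual of `H¹(K_∞, E[p^∞])`» WITHOUT the hypothesis `E(K)[p] = 0` — Greenberg's Thm. 4.1 regime
# (`Sel_E(F)_p` finite, `E(F)_p` ARBITRARY; LNM 1716 §4 p. 108 and p. 119) — UNCONDITIONAL

Seat `bsd-inputs-k4-p1` (gen 7; LADDER-BSD D-0154 KEY (147)(f) «prove the printed input», row 1 K4 INPUTS; Greenberg
1999), `--supports stmt-BirchSwinnertonDyer-20309`. THEOREMS ONLY (no definition, no named fact, no `sorry`). Part 2 of 2:
part 1 (`PublishedInputsGreenbergShaTwoFiniteAnyTorsion`) proved that `Ш²(K, E[p^∞])` is FINITE, of order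
`≤ #E[p^∞]^{Γ_K} · #Sel_{p^∞}(E/K)`, whenever `Sel_{p^∞}(E/K)` is finite — with NO hypothesis on the rational `p`-torsion
(the K4 chain of w2 / this lineage had `E(K)[p] = 0` throughout, through the injectivity of
`H¹(K, E[p^k]) → H¹(K, E[p^∞])`). This file draws the consequences, in the three ranges where the tree's divisibility
arguments for `Ш²` run, with `Sel_{p^∞}(E/K)` finite as the ONLY hypothesis on `E`:

* §1 `Ш²(K, E[p^∞]) = 0`: **`shaTwo_primary_eq_bot_of_ne_two`** (every number field `K`, `p` odd: finite + `p`-primary +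
  `p`-divisible by this lineage's `exists_nsmul_eq_of_mem_shaTwo_of_ne_two`), **`shaTwo_primary_eq_bot_real`** (`K` totally
  real — e.g. `K = ℚ` — EVERY `p` including `p = 2`: w2's `ShaTwo.exists_nsmul_eq_of_mem_shaTwo` with the archimedean
  Poitou–Tate rows), **`shaTwo_primary_eq_bot_complex`** (`K` totally complex, every `p`); UNCONDITIONAL — the Poitou–Tate
  rows are the tree theorems `SignedEC.PoitouTateShaRat.poitouTate_sha_tateDual_numberField` (Milne I 4.10 (a)),
  `SignedEC.ShaThreeBrauer.poitouTate_three_realPlaces_injective_holds` (4.10 (c)₃),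
  `poitouTate_two_realPlaces_surjective_holds` (Cor. 4.16); the `…_of_poitouTate` forms keep them as named hypotheses.
* §2 along EVERY `ℤ_p`-extension `κ` with topological generator `γ`, same three ranges, NO torsion hypothesis:
  DIV **`forall_exists_conjH1_sub_eq_{of_ne_two,real,complex}`** — every class of `H¹(Gal(K̄/K_∞), E[p^∞])` is
  `conj_γ t − t`, i.e. `H¹(K_∞, E[p^∞])_Γ = 0`: Greenberg p. 119 «We must now explain why `H¹(F_Σ/F_∞, E[p^∞])_Γ` is zero,
  under the hypotheses of theorem 4.1» (the input of the exact second row of Lemma 4.7, p. 108), here for the full group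
  and now in the WHOLE Thm. 4.1 regime (rational `p`-torsion allowed); and
  **`dual_forall_finite_eq_bot_{of_ne_two,real,complex}`** — no nonzero finite `Λ`-submodule in the Pontryagin dual (the
  conclusion of Prop. 4.9 / 4.12 for the full group); both by this lineage's `…_of_shaTwo_eq_bot` doors
  (`…DivOfShaTwoAnyField`, `…NoFiniteSubmoduleOfShaTwo`: Hochschild–Serre `H¹(K_∞, A)_Γ ↪ H²(K, A)`).

HONEST FRAMING: compositions of kernel-checked theorems of the K4 line (w2 g5, w3 g9, this lineage gens 0–3) and of cell
bsd-schneider (Poitou–Tate); the new mathematics is part 1 (the torsion-tolerant bound). These are NOT Greenberg's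
Prop. 4.9 / 4.12 as printed (those are about `H¹(F_Σ/F_∞, E[p^∞])` under `Λ`-cotorsion / `Λ`-corank hypotheses, via
`H²(Gal(F_Σ/F), Hom(Λ, E[p^∞]))`); they are the same conclusions for the full group `H¹(Gal(K̄/K_∞), E[p^∞])` in the regime
«`Sel_{p^∞}(E/K)` finite» — now INCLUDING rational `p`-torsion. The `Σ`-ramified version `(H_Σ)_Γ = 0` with torsion
(this lineage's `SigmaDiv` descends DIV to `H_Σ` only through Cassels' surjectivity, i.e. with `E(K)[p] = 0`), Lemma 4.6
(surjectivity onto `𝒫_E^Σ(F_∞)`) and Cassels' cokernel `E(F)_p^` (Lemma 4.7) are NOT touched, so the `E(ℚ)[p] ≠ 0` case of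
`greenberg_charValue_rankZero` stays open. Closes no item; no crux and no summit statement is proved by this seat; the
Birch–Swinnerton-Dyer conjecture is NOT proved by any of this.

References: [GreenbergLNM1716] §4 Thm. 4.1 (p. 102), Lemma 4.7 (pp. 107–108), p. 119, Appendix Prop. 4.9, 4.10, 4.12
(pp. 113–119); [MilneADT2006] I Thm. 4.10 (a),(c), Cor. 4.16, Lemma 6.12, Thm. 6.13 (c); [SerreGaloisCohomology1997]
II §4.4 Prop. 13; [Washington1997] §13.2.
-/

noncomputable section

open scoped Classical NumberField ContRepresentation

namespace Summit.BirchSwinnertonDyer.BirchSwinnertonDyer.Theorems.InputsGreenbergShaTwoAnyTorsion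

open CategoryTheory NumberField IsDedekindDomain Field Function WeierstrassCurve
open Literature.NumberTheory.EllipticCurves Literature.NumberTheory.GaloisRepresentations
open Literature.NumberTheory.GaloisRepresentations.DiscreteGaloisModule (sha shaTwo mem_sha_iff mem_shaTwo_iff tateDual)
open Literature.NumberTheory.GaloisCohomology Literature.NumberTheory.EllipticCurves.IwasawaAlgebra
open Summit.BirchSwinnertonDyer.Rank1Residual.X11b (LocBridge.primaryGaloisModule)
open Summit.BirchSwinnertonDyer.Rank1Residual.X11b.Levels
open Summit.BirchSwinnertonDyer.BirchSwinnertonDyer.Theorems.SignedEC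

/-! ## §1 `Ш²(K, E[p^∞]) = 0`, `Sel_{p^∞}(E/K)` finite being the only hypothesis on `E` -/

section Vanishing

variable {K : Type} [Field K] [NumberField K] (W : WeierstrassCurve K) [W.IsElliptic] (p : ℕ) [hp : Fact p.Prime]

/-- **`Ш²(K, E[p^∞]) = 0` for every number field `K` and every ODD prime `p`, whenever `Sel_{p^∞}(E/K)` is finite —
NO hypothesis on `E(K)[p]`, modulo Poitou–Tate (a) taken by name.** Finite (part 1), `p`-primary and `p`-divisible inside
`Ш²` (this lineage's `exists_nsmul_eq_of_mem_shaTwo_of_ne_two`: `cd_p(Γ_K) ≤ 2`, `H²(K_v, E[p^∞]) = 0`), hence zero.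
[cite: MilneADT2006, Ch. I, Thm. 4.10 (a), Lemma 6.12, Thm. 6.13 (c)] [cite: SerreGaloisCohomology1997, II §4.4 Prop. 13] -/
theorem forall_mem_shaTwo_primary_eq_zero_of_ne_two_of_poitouTate (hp2 : p ≠ 2) (hPT : poitouTate_sha_tateDual K)
    [Finite (W.selmerGroupPInfty p)] :
    ∀ c ∈ shaTwo (LocBridge.primaryGaloisModule W p), c = 0 := by
  haveI := (finite_shaTwo_primary_and_natCard_le W p hPT).1
  exact ShaTwo.eq_zero_of_finite_of_primary_of_divisible p (shaTwo (LocBridge.primaryGaloisModule W p))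
    (fun c _ ↦ Summit.BirchSwinnertonDyer.Rank1Residual.X11b.WeakLeopoldt.exists_pow_smul_eq_zero W p c)
    (fun c hc ↦ PrimaryTorsionH2.exists_nsmul_eq_of_mem_shaTwo_of_ne_two W p hp2 c hc)

/-- **`Ш²(K, E[p^∞]) = ⊥` for every number field `K`, every ODD prime `p`, every elliptic `W/K` with `Sel_{p^∞}(E/K)`
finite — UNCONDITIONAL and with NO hypothesis on `E(K)[p]`** (Poitou–Tate (a) is the tree theorem
`SignedEC.PoitouTateShaRat.poitouTate_sha_tateDual_numberField`). This is the regime of Greenberg's Thm. 4.1 (rational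
`p`-torsion allowed). [cite: MilneADT2006, Ch. I, Thm. 4.10 (a), Thm. 6.13 (c)] [cite: GreenbergLNM1716, §4 Thm. 4.1, p. 119] -/
theorem shaTwo_primary_eq_bot_of_ne_two (hp2 : p ≠ 2) [Finite (W.selmerGroupPInfty p)] :
    shaTwo (LocBridge.primaryGaloisModule W p) = ⊥ := by
  rw [eq_bot_iff]
  intro c hc
  rw [AddSubgroup.mem_bot]
  exact forall_mem_shaTwo_primary_eq_zero_of_ne_two_of_poitouTate W p hp2
    (PoitouTateShaRat.poitouTate_sha_tateDual_numberField K) c hc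

/-- **`Ш²(K, E[p^∞]) = 0` for `K` totally real, EVERY prime `p` (including `p = 2`), `Sel_{p^∞}(E/K)` finite — NO
hypothesis on `E(K)[p]`, modulo the three Poitou–Tate rows taken by name** (`poitouTate_sha_tateDual K`,
`poitouTate_three_realPlaces_injective K`, `poitouTate_two_realPlaces_surjective K`): finite (part 1), `p`-primary and
`p`-divisible (w2's `ShaTwo.exists_nsmul_eq_of_mem_shaTwo`, with the finite-place vanishing `H²(K_v, E[p^∞]) = 0` of this
lineage, `PrimaryTorsionH2.subsingleton_galoisCohomology_two_toLocal_primaryTorsion`).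
[cite: MilneADT2006, Ch. I, Thm. 4.10 (a),(c), Cor. 4.16, Lemma 6.12, Thm. 6.13 (c)] -/
theorem forall_mem_shaTwo_primary_eq_zero_real_of_poitouTate [IsTotallyReal K] (hPT : poitouTate_sha_tateDual K)
    (h3 : poitouTate_three_realPlaces_injective K) (h2 : poitouTate_two_realPlaces_surjective K)
    [Finite (W.selmerGroupPInfty p)] :
    ∀ c ∈ shaTwo (LocBridge.primaryGaloisModule W p), c = 0 := by
  haveI := (finite_shaTwo_primary_and_natCard_le W p hPT).1
  have hfin : ∀ (v : HeightOneSpectrum (𝓞 K))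
      (Z : galoisCohomology ((LocBridge.primaryGaloisModule W p).toLocal (Sum.inr v)) 2), Z = 0 := fun v Z ↦ by
    haveI := PrimaryTorsionH2.subsingleton_galoisCohomology_two_toLocal_primaryTorsion W p v
      (LocBridge.primaryGaloisModule W p) (fun _ _ ↦ rfl)
    exact Subsingleton.elim _ _
  exact ShaTwo.eq_zero_of_finite_of_primary_of_divisible p (shaTwo (LocBridge.primaryGaloisModule W p))
    (fun c _ ↦ Summit.BirchSwinnertonDyer.Rank1Residual.X11b.WeakLeopoldt.exists_pow_smul_eq_zero W p c)
    (fun c hc ↦ ShaTwo.exists_nsmul_eq_of_mem_shaTwo W p h3 h2 hfin c hc)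

/-- **`Ш²(K, E[p^∞]) = ⊥` for `K` totally real (in particular `K = ℚ`), EVERY prime `p`, every elliptic `W/K` with
`Sel_{p^∞}(E/K)` finite — UNCONDITIONAL, NO hypothesis on `E(K)[p]`** (the three Poitou–Tate rows are the tree
theorems `poitouTate_sha_tateDual_numberField`, `poitouTate_three_realPlaces_injective_holds`,
`poitouTate_two_realPlaces_surjective_holds`). [cite: MilneADT2006, Ch. I, Thm. 4.10 (a),(c), Cor. 4.16, Thm. 6.13 (c)]
[cite: GreenbergLNM1716, §4 Thm. 4.1, p. 119] -/
theorem shaTwo_primary_eq_bot_real [IsTotallyReal K] [Finite (W.selmerGroupPInfty p)] :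
    shaTwo (LocBridge.primaryGaloisModule W p) = ⊥ := by
  rw [eq_bot_iff]
  intro c hc
  rw [AddSubgroup.mem_bot]
  exact forall_mem_shaTwo_primary_eq_zero_real_of_poitouTate W p
    (PoitouTateShaRat.poitouTate_sha_tateDual_numberField K)
    (ShaThreeBrauer.poitouTate_three_realPlaces_injective_holds K) (poitouTate_two_realPlaces_surjective_holds K) c hc

/-- **`Ш²(K, E[p^∞]) = 0` for `K` totally complex, EVERY prime `p`, `Sel_{p^∞}(E/K)` finite — NO hypothesis on
`E(K)[p]`, modulo Poitou–Tate (a) taken by name**: finite (part 1), `p`-primary and `p`-divisible (this lineage's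
`exists_nsmul_eq_of_mem_shaTwo_of_isTotallyComplex`: `cd_p(Γ_K) ≤ 2` for totally complex `K`, every `p`).
[cite: MilneADT2006, Ch. I, Thm. 4.10 (a), Lemma 6.12, Thm. 6.13 (c)] [cite: SerreGaloisCohomology1997, II §4.4 Prop. 13] -/
theorem forall_mem_shaTwo_primary_eq_zero_complex_of_poitouTate [IsTotallyComplex K] (hPT : poitouTate_sha_tateDual K)
    [Finite (W.selmerGroupPInfty p)] :
    ∀ c ∈ shaTwo (LocBridge.primaryGaloisModule W p), c = 0 := by
  haveI := (finite_shaTwo_primary_and_natCard_le W p hPT).1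
  exact ShaTwo.eq_zero_of_finite_of_primary_of_divisible p (shaTwo (LocBridge.primaryGaloisModule W p))
    (fun c _ ↦ Summit.BirchSwinnertonDyer.Rank1Residual.X11b.WeakLeopoldt.exists_pow_smul_eq_zero W p c)
    (fun c hc ↦ PrimaryTorsionH2.exists_nsmul_eq_of_mem_shaTwo_of_isTotallyComplex W p c hc)

/-- **`Ш²(K, E[p^∞]) = ⊥` for `K` totally complex, every prime `p`, every elliptic `W/K` with `Sel_{p^∞}(E/K)` finite —
UNCONDITIONAL, NO hypothesis on `E(K)[p]`.** [cite: MilneADT2006, Ch. I, Thm. 4.10 (a), Thm. 6.13 (c)]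
[cite: GreenbergLNM1716, §4 Thm. 4.1, p. 119] -/
theorem shaTwo_primary_eq_bot_complex [IsTotallyComplex K] [Finite (W.selmerGroupPInfty p)] :
    shaTwo (LocBridge.primaryGaloisModule W p) = ⊥ := by
  rw [eq_bot_iff]
  intro c hc
  rw [AddSubgroup.mem_bot]
  exact forall_mem_shaTwo_primary_eq_zero_complex_of_poitouTate W p
    (PoitouTateShaRat.poitouTate_sha_tateDual_numberField K) c hc

end Vanishing

/-! ## §2 DIV and «no nonzero finite `Λ`-submodule» along every `ℤ_p`-extension, no torsion hypothesis -/

section Iwasawa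

variable {K : Type} [Field K] [NumberField K] (W : WeierstrassCurve K) [W.IsElliptic] (p : ℕ) [hp : Fact p.Prime]
  (κ : ZpExtension K p) {γ : absoluteGaloisGroup K}

/-- **DIV at an odd prime, every number field, NO torsion hypothesis — UNCONDITIONAL**: for every `ℤ_p`-extension
`κ` of `K` (`p ≠ 2`), topological generator `γ`, and elliptic `W/K` with `Sel_{p^∞}(E/K)` finite, every class
`s ∈ H¹(Gal(K̄/K_∞), E[p^∞])` is `conj_γ t − t`. Greenberg p. 119 «`H¹(F_Σ/F_∞, E[p^∞])_Γ` is zero, under the hypotheses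
of theorem 4.1» for the full group, now in the whole Thm. 4.1 regime (rational `p`-torsion allowed).
[cite: GreenbergLNM1716, §4 Thm. 4.1, Lemma 4.7 (p. 108), p. 119, Appendix Prop. 4.10, 4.12]
[cite: MilneADT2006, Ch. I, Thm. 4.10 (a)] -/
theorem forall_exists_conjH1_sub_eq_of_ne_two (hp2 : p ≠ 2) (hγ : κ.IsTopGenerator γ)
    [Finite (W.selmerGroupPInfty p)] (s : W.subgroupH1 p κ.kerSubgroup) :
    ∃ t : W.subgroupH1 p κ.kerSubgroup, W.conjH1 p κ.kerSubgroup γ t - t = s :=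
  PrimaryTorsionH2.forall_exists_conjH1_sub_eq_of_shaTwo_eq_bot W p κ hγ (shaTwo_primary_eq_bot_of_ne_two W p hp2) s

/-- **No nonzero finite `Λ`-submodule in the Pontryagin dual of `H¹(K_∞, E[p^∞])` at an odd prime, every number field,
NO torsion hypothesis — UNCONDITIONAL** (Greenberg's Prop. 4.9 / 4.12 conclusion for the full group
`H¹(Gal(K̄/K_∞), E[p^∞])`, regime `Sel_{p^∞}(E/K)` finite): for every `Λ`-module `Y` mapped injectively into
`Hom(H¹(K_∞, E[p^∞]), ℚ/ℤ)` with `T` acting as `conj_γ − 1`.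
[cite: GreenbergLNM1716, §4 Appendix Prop. 4.9 (p. 113), Prop. 4.12 (p. 119)] [cite: Washington1997, §13.2] -/
theorem dual_forall_finite_eq_bot_of_ne_two (hp2 : p ≠ 2) (hγ : κ.IsTopGenerator γ)
    [Finite (W.selmerGroupPInfty p)]
    {Y : Type*} [AddCommGroup Y] [Module (IwasawaAlgebra p) Y]
    (dY : Y →+ (W.subgroupH1 p κ.kerSubgroup →+ AddCircle (1 : ℚ))) (hinj : Function.Injective dY)
    (hT : ∀ (y : Y) (x : W.subgroupH1 p κ.kerSubgroup),
      dY ((PowerSeries.X : IwasawaAlgebra p) • y) x = dY y (W.conjH1 p κ.kerSubgroup γ x) - dY y x) :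
    ∀ N : Submodule (IwasawaAlgebra p) Y, Finite N → N = ⊥ :=
  PrimaryTorsionH2.dual_forall_finite_eq_bot_of_shaTwo_eq_bot W p κ hγ (shaTwo_primary_eq_bot_of_ne_two W p hp2)
    dY hinj hT

/-- **DIV for `K` totally real (e.g. `K = ℚ`), EVERY prime `p`, NO torsion hypothesis — UNCONDITIONAL**: for every
`ℤ_p`-extension `κ`, topological generator `γ`, and elliptic `W/K` with `Sel_{p^∞}(E/K)` finite, every class of
`H¹(Gal(K̄/K_∞), E[p^∞])` is `conj_γ t − t`. [cite: GreenbergLNM1716, §4 Thm. 4.1, p. 119, Appendix Prop. 4.10, 4.12]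
[cite: MilneADT2006, Ch. I, Thm. 4.10, Cor. 4.16, Thm. 6.13 (c)] -/
theorem forall_exists_conjH1_sub_eq_real [IsTotallyReal K] (hγ : κ.IsTopGenerator γ)
    [Finite (W.selmerGroupPInfty p)] (s : W.subgroupH1 p κ.kerSubgroup) :
    ∃ t : W.subgroupH1 p κ.kerSubgroup, W.conjH1 p κ.kerSubgroup γ t - t = s :=
  PrimaryTorsionH2.forall_exists_conjH1_sub_eq_of_shaTwo_eq_bot W p κ hγ (shaTwo_primary_eq_bot_real W p) s

/-- **No nonzero finite `Λ`-submodule in the Pontryagin dual of `H¹(K_∞, E[p^∞])`, `K` totally real, every `p`, NO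
torsion hypothesis — UNCONDITIONAL** (regime `Sel_{p^∞}(E/K)` finite).
[cite: GreenbergLNM1716, §4 Appendix Prop. 4.9 (p. 113), Prop. 4.12 (p. 119)] [cite: Washington1997, §13.2] -/
theorem dual_forall_finite_eq_bot_real [IsTotallyReal K] (hγ : κ.IsTopGenerator γ)
    [Finite (W.selmerGroupPInfty p)]
    {Y : Type*} [AddCommGroup Y] [Module (IwasawaAlgebra p) Y]
    (dY : Y →+ (W.subgroupH1 p κ.kerSubgroup →+ AddCircle (1 : ℚ))) (hinj : Function.Injective dY)
    (hT : ∀ (y : Y) (x : W.subgroupH1 p κ.kerSubgroup),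
      dY ((PowerSeries.X : IwasawaAlgebra p) • y) x = dY y (W.conjH1 p κ.kerSubgroup γ x) - dY y x) :
    ∀ N : Submodule (IwasawaAlgebra p) Y, Finite N → N = ⊥ :=
  PrimaryTorsionH2.dual_forall_finite_eq_bot_of_shaTwo_eq_bot W p κ hγ (shaTwo_primary_eq_bot_real W p) dY hinj hT

/-- **DIV for `K` totally complex, every prime `p`, NO torsion hypothesis — UNCONDITIONAL**: every class of
`H¹(Gal(K̄/K_∞), E[p^∞])` is `conj_γ t − t` along every `ℤ_p`-extension, when `Sel_{p^∞}(E/K)` is finite.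
[cite: GreenbergLNM1716, §4 Thm. 4.1, p. 119, Appendix Prop. 4.10, 4.12] [cite: MilneADT2006, Ch. I, Thm. 4.10 (a)] -/
theorem forall_exists_conjH1_sub_eq_complex [IsTotallyComplex K] (hγ : κ.IsTopGenerator γ)
    [Finite (W.selmerGroupPInfty p)] (s : W.subgroupH1 p κ.kerSubgroup) :
    ∃ t : W.subgroupH1 p κ.kerSubgroup, W.conjH1 p κ.kerSubgroup γ t - t = s :=
  PrimaryTorsionH2.forall_exists_conjH1_sub_eq_of_shaTwo_eq_bot W p κ hγ (shaTwo_primary_eq_bot_complex W p) s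

/-- **No nonzero finite `Λ`-submodule in the Pontryagin dual of `H¹(K_∞, E[p^∞])`, `K` totally complex, every `p`, NO
torsion hypothesis — UNCONDITIONAL** (regime `Sel_{p^∞}(E/K)` finite).
[cite: GreenbergLNM1716, §4 Appendix Prop. 4.9 (p. 113), Prop. 4.12 (p. 119)] [cite: Washington1997, §13.2] -/
theorem dual_forall_finite_eq_bot_complex [IsTotallyComplex K] (hγ : κ.IsTopGenerator γ)
    [Finite (W.selmerGroupPInfty p)]
    {Y : Type*} [AddCommGroup Y] [Module (IwasawaAlgebra p) Y]
    (dY : Y →+ (W.subgroupH1 p κ.kerSubgroup →+ AddCircle (1 : ℚ))) (hinj : Function.Injective dY)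
    (hT : ∀ (y : Y) (x : W.subgroupH1 p κ.kerSubgroup),
      dY ((PowerSeries.X : IwasawaAlgebra p) • y) x = dY y (W.conjH1 p κ.kerSubgroup γ x) - dY y x) :
    ∀ N : Submodule (IwasawaAlgebra p) Y, Finite N → N = ⊥ :=
  PrimaryTorsionH2.dual_forall_finite_eq_bot_of_shaTwo_eq_bot W p κ hγ (shaTwo_primary_eq_bot_complex W p) dY hinj hT

end Iwasawa

end Summit.BirchSwinnertonDyer.BirchSwinnertonDyer.Theorems.InputsGreenbergShaTwoAnyTorsion

end
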